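import Literature.Analysis.FluidPDE.NSRobustnessOfRegularityHalfFlux
import HarnessLib

/-!
# Robustness of regularity on `ℝ³`, smoothing vein II: the DISSIPATION BUDGET of the difference of
# two classical solutions in strain currency

Analysis/FluidPDE proof file (theorems only; no definitions, no named facts, no `sorry`); fifth file
of the vein `NSRobustnessOfRegularity` → `…H2` → `…SupNorm` → `…HalfFlux`.

* `IsClassicalNSSolutionOn.hessianDefect_eq_laplacian_and_continuousOn` — along two classical
  solutions of the `L²`-Sobolev class on `[0, T] × ℝ³`, `Σᵢ∫|∇∂ᵢ(v − u)(t)|²_F = ∫‖Δ(v − u)(t)‖²`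
  and this is continuous on `[0, T]` (`hessian_sub_balance_forces` + the Hessian–Laplacian identity).
* `IsClassicalNSSolutionOn.dissipation_sub_le_R3` — **the dissipation budget** (RRS 2016, proof of
  Thm 9.1, Step 1 integrated with half the dissipation kept): for `(u,p)` (force `f`), `(v,q)`
  (force `g`) classical on `[0, T] × ℝ³` in the class, continuous majorants `G` (compression rate of
  `Du`), `σ₂ ≥ ‖D²u‖_∞`, `L ≥ ‖v − u‖_{L²}`, `X₁ ≥ ∫|∇(v − u)|²_F`, `H₀ ≥ ∫‖f − g‖²`, `κ > 0`,
  and every `b ∈ [0, T]`: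
  `∫|∇(v − u)(b)|²_F + ν∫₀ᵇ∫‖Δ(v − u)‖² ≤ ∫|∇(v − u)(0)|²_F + ∫₀ᵇ φ`,
  `φ = (4G + 3κσ₂)X₁ + 4A⁴X₁³/ν³ + 4H₀/ν + 3σ₂L²/κ` (`A = agmonConst`).

WHAT THIS IS NOT: not a statement about Navier–Stokes regularity or blow-up — a-priori calculus
between two GIVEN classical solutions. Consumer: cell `ns-blowup`, crux 20303 `EpisodeBaseT`.

## Mathlib / tree search

Tree: `IsClassicalNSSolutionOn.enstrophy_sub_balance_forces`, `…hessian_sub_balance_forces`,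
`robustness_flux_le_strain_half_R3`, `linfty_bound_of_hasBoundedSobolevNormsOn_holds`,
`exists_forall_norm_fderiv_le_of_hasBoundedSobolevNormsOn`. Mathlib: `intervalIntegral.integral_mono_on`.

## References

* P. Constantin, C. Foias, *Navier–Stokes Equations*, Univ. Chicago Press 1988, Ch. 10
  (parabolic smoothing of strong solutions, the `t‖Au‖²` estimate). [ConstantinFoias1988]
* J. C. Robinson, J. L. Rodrigo, W. Sadowski, *The Three-Dimensional Navier–Stokes Equations*,
  CUP 2016, Thm 6.8 (proof), Thm 9.1, Thm 1.20. [RobinsonRodrigoSadowskiCUP2016]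
* M. Dashti, J. C. Robinson, SIAM J. Numer. Anal. 46 (2008) 3136–3150, Thm 2. [DashtiRobinson2008]
* E. M. Stein, *Singular Integrals and Differentiability Properties of Functions*, Princeton 1970,
  Ch. III §1.3. [Stein1971]
-/

noncomputable section

open MeasureTheory Set Function Filter Topology InnerProductSpace
open scoped ENNReal NNReal ContDiff RealInnerProductSpace Laplacian

namespace Literature.Analysis.FluidPDE

/-! ## §A Bookkeeping repeated from the preceding files of the vein (private) -/

section Helpers

/-- `∫⁻‖a − b‖² < ∞` from `∫⁻‖a‖², ∫⁻‖b‖² < ∞`. [folklore] -/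
private theorem h2s_lintegral_sq_sub_lt_top {G : Type*} [NormedAddCommGroup G]
    {a b : EuclideanSpace ℝ (Fin 3) → G}
    (ham : AEStronglyMeasurable a volume) (ha : ∫⁻ x, ‖a x‖ₑ ^ 2 < ⊤)
    (hb : ∫⁻ x, ‖b x‖ₑ ^ 2 < ⊤) : ∫⁻ x, ‖a x - b x‖ₑ ^ 2 < ⊤ :=
  lt_of_le_of_lt (lintegral_enorm_sq_sub_le (g := b) ham (μ := volume))
    (ENNReal.add_lt_top.2 ⟨ENNReal.mul_lt_top (by simp) ha, ENNReal.mul_lt_top (by simp) hb⟩)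

/-- Uniform `L²`-Sobolev bounds pass to slicewise differences. [folklore] -/
private theorem h2s_sobolev_sub {F : Type*} [NormedAddCommGroup F] [NormedSpace ℝ F]
    {S : Set ℝ} {a b c : ℝ → EuclideanSpace ℝ (Fin 3) → F}
    (habc : ∀ t ∈ S, ∀ x, c t x = a t x - b t x) (ha : ∀ t ∈ S, ContDiff ℝ ∞ (a t))
    (hb : ∀ t ∈ S, ContDiff ℝ ∞ (b t))
    (hA : ∀ n : ℕ, ∃ C : ℝ≥0, ∀ t ∈ S, ∫⁻ x, ‖iteratedFDeriv ℝ n (a t) x‖ₑ ^ 2 ≤ C)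
    (hB : ∀ n : ℕ, ∃ C : ℝ≥0, ∀ t ∈ S, ∫⁻ x, ‖iteratedFDeriv ℝ n (b t) x‖ₑ ^ 2 ≤ C) (n : ℕ) :
    ∃ C : ℝ≥0, ∀ t ∈ S, ∫⁻ x, ‖iteratedFDeriv ℝ n (c t) x‖ₑ ^ 2 ≤ C := by
  obtain ⟨Ca, hCa⟩ := hA n
  obtain ⟨Cb, hCb⟩ := hB n
  refine ⟨2 * Ca + 2 * Cb, fun t ht => ?_⟩
  have hc : c t = a t - b t := funext fun x => by rw [Pi.sub_apply, habc t ht x]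
  have hsub : ∀ x, iteratedFDeriv ℝ n (c t) x = iteratedFDeriv ℝ n (a t) x - iteratedFDeriv ℝ n (b t) x :=
    fun x => by
      rw [hc]
      exact iteratedFDeriv_sub_apply ((ha t ht).of_le (by exact_mod_cast le_top)).contDiffAt
        ((hb t ht).of_le (by exact_mod_cast le_top)).contDiffAt
  have hm : AEStronglyMeasurable (fun x => iteratedFDeriv ℝ n (a t) x) volume :=
    ((ha t ht).continuous_iteratedFDeriv (by exact_mod_cast le_top)).aestronglyMeasurable
  calc ∫⁻ x, ‖iteratedFDeriv ℝ n (c t) x‖ₑ ^ 2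
      = ∫⁻ x, ‖iteratedFDeriv ℝ n (a t) x - iteratedFDeriv ℝ n (b t) x‖ₑ ^ 2 :=
        lintegral_congr fun x => by rw [hsub]
    _ ≤ 2 * (∫⁻ x, ‖iteratedFDeriv ℝ n (a t) x‖ₑ ^ 2) + 2 * ∫⁻ x, ‖iteratedFDeriv ℝ n (b t) x‖ₑ ^ 2 :=
        lintegral_enorm_sq_sub_le hm
    _ ≤ 2 * (Ca : ℝ≥0∞) + 2 * (Cb : ℝ≥0∞) := by
        gcongr
        · exact hCa t ht
        · exact hCb t ht
    _ = ((2 * Ca + 2 * Cb : ℝ≥0) : ℝ≥0∞) := by push_cast; rfl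

/-- Uniform-in-time Sobolev bound, at one time: `∫⁻‖Dⁿ(c t)‖² < ∞`. [folklore] -/
private theorem h2s_fin {F : Type*} [NormedAddCommGroup F] [NormedSpace ℝ F] {S : Set ℝ}
    {c : ℝ → EuclideanSpace ℝ (Fin 3) → F} {t : ℝ} (ht : t ∈ S) (n : ℕ)
    (hC : ∃ C : ℝ≥0, ∀ s ∈ S, ∫⁻ x, ‖iteratedFDeriv ℝ n (c s) x‖ₑ ^ 2 ≤ C) :
    ∫⁻ x, ‖iteratedFDeriv ℝ n (c t) x‖ₑ ^ 2 < ⊤ := by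
  obtain ⟨C, hC⟩ := hC
  exact lt_of_le_of_lt (hC t ht) ENNReal.coe_lt_top

/-- A bound of the compression rate of a divergence-free field is nonnegative (trace). [folklore] -/
private theorem h2s_compressionRate_nonneg
    {u₀ : EuclideanSpace ℝ (Fin 3) → EuclideanSpace ℝ (Fin 3)} (hdiv : VectorCalculus.IsDivFree u₀)
    {G : ℝ} (hG : ∀ (x ξ : EuclideanSpace ℝ (Fin 3)), -⟪fderiv ℝ u₀ x ξ, ξ⟫ ≤ G * ‖ξ‖ ^ 2) :
    0 ≤ G := by
  have hd := hdiv 0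
  rw [divergence_eq_sum_inner_fderiv (EuclideanSpace.basisFun (Fin 3) ℝ), Fin.sum_univ_three] at hd
  have he : ∀ i, ‖EuclideanSpace.basisFun (Fin 3) ℝ i‖ = 1 := fun i => by simp
  have h0 := hG 0 (EuclideanSpace.basisFun (Fin 3) ℝ 0)
  have h1 := hG 0 (EuclideanSpace.basisFun (Fin 3) ℝ 1)
  have h2 := hG 0 (EuclideanSpace.basisFun (Fin 3) ℝ 2)
  rw [he, one_pow, mul_one, real_inner_comm] at h0 h1 h2
  linarith

end Helpers

/-! ## §F The dissipation budget along two classical solutions of the class -/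

section Dissipation

variable {ν T : ℝ} {f g u v : ℝ → EuclideanSpace ℝ (Fin 3) → EuclideanSpace ℝ (Fin 3)}
variable {p q : ℝ → EuclideanSpace ℝ (Fin 3) → ℝ}

/-- **The `H²` defect of the difference is its `H¹` dissipation density and is continuous in
time**: along two classical solutions of the `L²`-Sobolev class on `[0, T] × ℝ³`,
`Σᵢ∫|∇∂ᵢ(v − u)(t)|²_F = ∫‖Δ(v − u)(t)‖²` for `t ∈ [0, T]`, and this quantity is continuous on
`[0, T]` (`IsClassicalNSSolutionOn.hessian_sub_balance_forces`). [cite: DashtiRobinson2008, Thm 2 (proof)] -/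
theorem IsClassicalNSSolutionOn.hessianDefect_eq_laplacian_and_continuousOn (hT : 0 < T)
    (hv : IsClassicalNSSolutionOn (Icc 0 T) ν g v q) (hu : IsClassicalNSSolutionOn (Icc 0 T) ν f u p)
    (hU : HasBoundedSobolevNormsOn (Icc 0 T) u)
    (hUt : HasBoundedSobolevNormsOn (Icc 0 T) (timeDerivWithin (Icc 0 T) u))
    (hp : ∀ n : ℕ, ∃ C : ℝ≥0, ∀ t ∈ Icc 0 T, ∫⁻ x, ‖iteratedFDeriv ℝ n (p t) x‖ₑ ^ 2 ≤ C)
    (hV : HasBoundedSobolevNormsOn (Icc 0 T) v)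
    (hVt : HasBoundedSobolevNormsOn (Icc 0 T) (timeDerivWithin (Icc 0 T) v))
    (hq : ∀ n : ℕ, ∃ C : ℝ≥0, ∀ t ∈ Icc 0 T, ∫⁻ x, ‖iteratedFDeriv ℝ n (q t) x‖ₑ ^ 2 ≤ C) :
    (∀ t ∈ Icc 0 T, (∑ i, ∫ x, frobeniusNormSq
        (fderiv ℝ (fun y => fderiv ℝ ((v - u) t) y (EuclideanSpace.basisFun (Fin 3) ℝ i)) x)) =
      ∫ x, ‖(Δ ((v - u) t)) x‖ ^ 2) ∧
    ContinuousOn (fun t => ∫ x, ‖(Δ ((v - u) t)) x‖ ^ 2) (Icc 0 T) := by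
  have hU' : UniqueDiffOn ℝ (Icc 0 T) := uniqueDiffOn_Icc hT
  have hwsm : IsSmoothSpaceTimeOn (Icc 0 T) (v - u) := hv.smooth_velocity.sub hu.smooth_velocity
  have hwsob : ∀ n : ℕ, ∃ C : ℝ≥0, ∀ s ∈ Icc 0 T, ∫⁻ x, ‖iteratedFDeriv ℝ n ((v - u) s) x‖ₑ ^ 2 ≤ C :=
    h2s_sobolev_sub (fun s _ x => rfl) (fun s hs => hv.contDiff_velocity hs)
      (fun s hs => hu.contDiff_velocity hs) hV hU
  have heq : ∀ t ∈ Icc 0 T, (∑ i, ∫ x, frobeniusNormSq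
        (fderiv ℝ (fun y => fderiv ℝ ((v - u) t) y (EuclideanSpace.basisFun (Fin 3) ℝ i)) x)) =
      ∫ x, ‖(Δ ((v - u) t)) x‖ ^ 2 := fun t ht =>
    sum_integral_frobeniusNormSq_fderiv_fderiv_eq_integral_laplacian_sq (hwsm.contDiff_slice ht)
      (h2s_fin ht 1 (hwsob 1)) (h2s_fin ht 2 (hwsob 2)) (h2s_fin ht 3 (hwsob 3))
  have hfD : ∀ t ∈ Icc 0 T, ∫⁻ x, ‖fderiv ℝ (f t) x‖ₑ ^ 2 < ⊤ := fun t ht =>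
    hu.lintegral_enorm_sq_fderiv_force_lt_top hU' hU hUt hp ht
  have hgD : ∀ t ∈ Icc 0 T, ∫⁻ x, ‖fderiv ℝ (g t) x‖ₑ ^ 2 < ⊤ := fun t ht =>
    hv.lintegral_enorm_sq_fderiv_force_lt_top hU' hV hVt hq ht
  obtain ⟨-, hZc, -⟩ := hv.hessian_sub_balance_forces hT hu hU hUt hp hV hVt hq hfD hgD
  exact ⟨heq, hZc.congr fun t ht => (heq t ht).symm⟩

/-- **The dissipation budget of the difference of two classical solutions, strain form**
(RRS 2016, proof of Thm 9.1, Step 1 integrated in time with half the dissipation kept): for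
`(u, p)` (force `f`, the reference) and `(v, q)` (force `g`) classical on `[0, T] × ℝ³` in the
`L²`-Sobolev class, continuous majorants on `[0, T]` of the compression rate `G` of `Du`
(`−⟪Du ξ, ξ⟫ ≤ G‖ξ‖²`), `σ₂ ≥ ‖D²u‖_∞`, `L ≥ ‖(v − u)(s)‖_{L²}`, `X₁ ≥ ∫|∇(v − u)(s)|²_F` and
`H₀ ≥ ∫‖(f − g)(s)‖²`, a free length `κ > 0`, and every `b ∈ [0, T]`:
`∫|∇(v − u)(b)|²_F + ν∫₀ᵇ∫‖Δ(v − u)‖² ≤ ∫|∇(v − u)(0)|²_F + ∫₀ᵇ φ`,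
`φ = (4G + 3κσ₂)X₁ + 4A⁴X₁³/ν³ + 4H₀/ν + 3σ₂L²/κ` (`A = agmonConst`).
[cite: RobinsonRodrigoSadowskiCUP2016, Thm 9.1 (proof, Step 1) and Exercise 9.4] -/
theorem IsClassicalNSSolutionOn.dissipation_sub_le_R3 (hν : 0 < ν) (hT : 0 < T)
    (hv : IsClassicalNSSolutionOn (Icc 0 T) ν g v q) (hu : IsClassicalNSSolutionOn (Icc 0 T) ν f u p)
    (hU : HasBoundedSobolevNormsOn (Icc 0 T) u)
    (hUt : HasBoundedSobolevNormsOn (Icc 0 T) (timeDerivWithin (Icc 0 T) u))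
    (hp : ∀ n : ℕ, ∃ C : ℝ≥0, ∀ t ∈ Icc 0 T, ∫⁻ x, ‖iteratedFDeriv ℝ n (p t) x‖ₑ ^ 2 ≤ C)
    (hV : HasBoundedSobolevNormsOn (Icc 0 T) v)
    (hVt : HasBoundedSobolevNormsOn (Icc 0 T) (timeDerivWithin (Icc 0 T) v))
    (hq : ∀ n : ℕ, ∃ C : ℝ≥0, ∀ t ∈ Icc 0 T, ∫⁻ x, ‖iteratedFDeriv ℝ n (q t) x‖ₑ ^ 2 ≤ C)
    {G σ₂ L X₁ H₀ : ℝ → ℝ} {κ : ℝ} (hκ : 0 < κ)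
    (hG : ∀ s ∈ Icc 0 T, ∀ (x ξ : EuclideanSpace ℝ (Fin 3)), -⟪fderiv ℝ (u s) x ξ, ξ⟫ ≤ G s * ‖ξ‖ ^ 2)
    (hσ₂ : ∀ s ∈ Icc 0 T, ∀ x, ‖iteratedFDeriv ℝ 2 (u s) x‖ ≤ σ₂ s)
    (hL : ∀ s ∈ Icc 0 T, Real.sqrt (∫ x, ‖(v - u) s x‖ ^ 2) ≤ L s)
    (hX₁ : ∀ s ∈ Icc 0 T, ∫ x, frobeniusNormSq (fderiv ℝ ((v - u) s) x) ≤ X₁ s)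
    (hH₀ : ∀ s ∈ Icc 0 T, ∫ x, ‖f s x - g s x‖ ^ 2 ≤ H₀ s)
    (hGc : ContinuousOn G (Icc 0 T)) (hσ₂c : ContinuousOn σ₂ (Icc 0 T))
    (hLc : ContinuousOn L (Icc 0 T)) (hX₁c : ContinuousOn X₁ (Icc 0 T))
    (hH₀c : ContinuousOn H₀ (Icc 0 T)) {b : ℝ} (hb : b ∈ Icc 0 T) :
    (∫ x, frobeniusNormSq (fderiv ℝ ((v - u) b) x)) +
        ν * ∫ s in (0 : ℝ)..b, ∫ x, ‖(Δ ((v - u) s)) x‖ ^ 2 ≤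
      (∫ x, frobeniusNormSq (fderiv ℝ ((v - u) 0) x)) +
        ∫ s in (0 : ℝ)..b, ((4 * G s + 3 * κ * σ₂ s) * X₁ s +
          4 * agmonConst ^ 4 * X₁ s ^ 3 / ν ^ 3 + 4 / ν * H₀ s + 3 * σ₂ s / κ * L s ^ 2) := by
  have hU' : UniqueDiffOn ℝ (Icc 0 T) := uniqueDiffOn_Icc hT
  -- (qualitative) sup bounds of the reference field and its gradient
  obtain ⟨Bu, hBu⟩ := linfty_bound_of_hasBoundedSobolevNormsOn_holds
    (fun s hs => (hu.contDiff_velocity hs).of_le (by norm_cast)) hU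
  obtain ⟨B₁, -, hB₁⟩ := exists_forall_norm_fderiv_le_of_hasBoundedSobolevNormsOn
    (fun s hs => (hu.contDiff_velocity hs).of_le (by norm_cast)) hU
  have hwsm : IsSmoothSpaceTimeOn (Icc 0 T) (v - u) := hv.smooth_velocity.sub hu.smooth_velocity
  have hwsob : ∀ n : ℕ, ∃ C : ℝ≥0, ∀ s ∈ Icc 0 T, ∫⁻ x, ‖iteratedFDeriv ℝ n ((v - u) s) x‖ₑ ^ 2 ≤ C :=
    h2s_sobolev_sub (fun s _ x => rfl) (fun s hs => hv.contDiff_velocity hs)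
      (fun s hs => hu.contDiff_velocity hs) hV hU
  have hfsm : IsSmoothSpaceTimeOn (Icc 0 T) f := hu.isSmoothSpaceTimeOn_force hU'
  have hgsm : IsSmoothSpaceTimeOn (Icc 0 T) g := hv.isSmoothSpaceTimeOn_force hU'
  -- signs
  have hσ0 : ∀ s ∈ Icc 0 T, 0 ≤ σ₂ s := fun s hs => (norm_nonneg _).trans (hσ₂ s hs 0)
  have hG0 : ∀ s ∈ Icc 0 T, 0 ≤ G s := fun s hs =>
    h2s_compressionRate_nonneg (hu.divFree s hs) (hG s hs)
  -- the balance, and the `H²` defect as the dissipation density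
  obtain ⟨hFint, -, hbal⟩ := hv.enstrophy_sub_balance_forces hT hu hU hUt hp hV hVt hq
  obtain ⟨-, hYc⟩ := hv.hessianDefect_eq_laplacian_and_continuousOn hT hu hU hUt hp hV hVt hq
  -- the pointwise slice bound with half the dissipation kept
  have hflux : ∀ s ∈ Icc 0 T,
      -(2 * ν * ∫ x, ‖(Δ ((v - u) s)) x‖ ^ 2) +
          2 * (∫ x, ⟪convect (v s) ((v - u) s) x + convect ((v - u) s) (u s) x,
            (Δ ((v - u) s)) x⟫) +
          2 * (∫ x, ⟪f s x - g s x, (Δ ((v - u) s)) x⟫) ≤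
        -(ν * ∫ x, ‖(Δ ((v - u) s)) x‖ ^ 2) +
          ((4 * G s + 3 * κ * σ₂ s) * X₁ s + 4 * agmonConst ^ 4 * X₁ s ^ 3 / ν ^ 3 +
            4 / ν * H₀ s + 3 * σ₂ s / κ * L s ^ 2) := by
    intro s hs
    have hw : ContDiff ℝ ∞ ((v - u) s) := hwsm.contDiff_slice hs
    have ch : Continuous fun x => f s x - g s x :=
      (hfsm.contDiff_slice hs).continuous.sub (hgsm.contDiff_slice hs).continuous
    have hh0 : ∫⁻ x, ‖f s x - g s x‖ₑ ^ 2 < ⊤ :=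
      h2s_lintegral_sq_sub_lt_top (hfsm.contDiff_slice hs).continuous.aestronglyMeasurable
        (hu.lintegral_enorm_sq_force_slice_lt_top hU' hU hUt hp hs)
        (hv.lintegral_enorm_sq_force_slice_lt_top hU' hV hVt hq hs)
    have key := robustness_flux_le_strain_half_R3 hν (hu.contDiff_velocity hs) hw ch (hu.divFree s hs)
      (h2s_fin hs 0 (hwsob 0)) (h2s_fin hs 1 (hwsob 1)) (h2s_fin hs 2 (hwsob 2))
      (h2s_fin hs 3 (hwsob 3)) hh0 (hBu s hs) (hB₁ s hs) (hG s hs) (hσ₂ s hs) (hL s hs) hκ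
    have e : (fun y => u s y + (v - u) s y) = v s := by
      funext y
      simp only [Pi.sub_apply]
      abel
    rw [e] at key
    -- monotonicity in the majorants `X ≤ X₁`, `∫‖f − g‖² ≤ H₀`
    have hX0 : 0 ≤ ∫ x, frobeniusNormSq (fderiv ℝ ((v - u) s) x) :=
      integral_nonneg fun x => frobeniusNormSq_nonneg _
    have hXle := hX₁ s hs
    have hHle := hH₀ s hs
    have hl0 : 0 ≤ 4 * G s + 3 * κ * σ₂ s := by
      have := hG0 s hs; have := hσ0 s hs; positivity
    have h1 : (4 * G s + 3 * κ * σ₂ s) * (∫ x, frobeniusNormSq (fderiv ℝ ((v - u) s) x)) ≤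
        (4 * G s + 3 * κ * σ₂ s) * X₁ s := mul_le_mul_of_nonneg_left hXle hl0
    have h2 : 4 * agmonConst ^ 4 * (∫ x, frobeniusNormSq (fderiv ℝ ((v - u) s) x)) ^ 3 / ν ^ 3 ≤
        4 * agmonConst ^ 4 * X₁ s ^ 3 / ν ^ 3 := by
      have hA := agmonConst_nonneg
      have := pow_le_pow_left₀ hX0 hXle 3
      have hν3 : 0 < ν ^ 3 := by positivity
      exact div_le_div_of_nonneg_right (mul_le_mul_of_nonneg_left this (by positivity)) hν3.le
    have h3 : 4 / ν * (∫ x, ‖f s x - g s x‖ ^ 2) ≤ 4 / ν * H₀ s :=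
      mul_le_mul_of_nonneg_left hHle (by positivity)
    linarith
  -- integrability on `[0, b]`
  have hsub : Icc 0 b ⊆ Icc 0 T := Icc_subset_Icc_right hb.2
  have hFi : IntervalIntegrable (fun t => -(2 * ν * ∫ x, ‖(Δ ((v - u) t)) x‖ ^ 2) +
        2 * (∫ x, ⟪convect (v t) ((v - u) t) x + convect ((v - u) t) (u t) x, (Δ ((v - u) t)) x⟫) +
        2 * (∫ x, ⟪f t x - g t x, (Δ ((v - u) t)) x⟫)) volume 0 b := by
    refine (hFint.mono_set ?_).intervalIntegrable
    rw [uIcc_of_le hb.1]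
    exact hsub
  have hφc : ContinuousOn (fun s => (4 * G s + 3 * κ * σ₂ s) * X₁ s +
      4 * agmonConst ^ 4 * X₁ s ^ 3 / ν ^ 3 + 4 / ν * H₀ s + 3 * σ₂ s / κ * L s ^ 2) (Icc 0 T) :=
    (((((continuousOn_const.mul hGc).add (continuousOn_const.mul hσ₂c)).mul hX₁c).add
      (((continuousOn_const.mul (hX₁c.pow 3)).div_const _))).add
      (continuousOn_const.mul hH₀c)).add
      (((continuousOn_const.mul hσ₂c).div_const _).mul (hLc.pow 2))
  have hYi : IntervalIntegrable (fun s => ∫ x, ‖(Δ ((v - u) s)) x‖ ^ 2) volume 0 b :=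
    (hYc.mono hsub).intervalIntegrable_of_Icc hb.1
  have hφi : IntervalIntegrable (fun s => (4 * G s + 3 * κ * σ₂ s) * X₁ s +
      4 * agmonConst ^ 4 * X₁ s ^ 3 / ν ^ 3 + 4 / ν * H₀ s + 3 * σ₂ s / κ * L s ^ 2) volume 0 b :=
    (hφc.mono hsub).intervalIntegrable_of_Icc hb.1
  have hGi : IntervalIntegrable (fun s => -(ν * ∫ x, ‖(Δ ((v - u) s)) x‖ ^ 2) +
      ((4 * G s + 3 * κ * σ₂ s) * X₁ s + 4 * agmonConst ^ 4 * X₁ s ^ 3 / ν ^ 3 +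
        4 / ν * H₀ s + 3 * σ₂ s / κ * L s ^ 2)) volume 0 b :=
    (hYi.const_mul ν).neg.add hφi
  have hmono := intervalIntegral.integral_mono_on hb.1 hFi hGi fun s hs => hflux s (hsub hs)
  have hsplit : (∫ s in (0 : ℝ)..b, (-(ν * ∫ x, ‖(Δ ((v - u) s)) x‖ ^ 2) +
      ((4 * G s + 3 * κ * σ₂ s) * X₁ s + 4 * agmonConst ^ 4 * X₁ s ^ 3 / ν ^ 3 +
        4 / ν * H₀ s + 3 * σ₂ s / κ * L s ^ 2))) =
      -(ν * ∫ s in (0 : ℝ)..b, ∫ x, ‖(Δ ((v - u) s)) x‖ ^ 2) +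
        ∫ s in (0 : ℝ)..b, ((4 * G s + 3 * κ * σ₂ s) * X₁ s +
          4 * agmonConst ^ 4 * X₁ s ^ 3 / ν ^ 3 + 4 / ν * H₀ s + 3 * σ₂ s / κ * L s ^ 2) := by
    have h1 : IntervalIntegrable (fun s => -(ν * ∫ x, ‖(Δ ((v - u) s)) x‖ ^ 2)) volume 0 b :=
      (hYi.const_mul ν).neg
    rw [intervalIntegral.integral_add h1 hφi, intervalIntegral.integral_neg,
      intervalIntegral.integral_const_mul]
  rw [hsplit] at hmono
  have hb' := hbal b hb
  linarith

end Dissipation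

end Literature.Analysis.FluidPDE
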